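import Summits.BirchSwinnertonDyer.BirchSwinnertonDyer.Theorems.ResidualThetaTransportAtTwoRlfTwistedCoresWitness
import Literature.NumberTheory.EllipticCurves.ZpExtensionGaloisTwistWeilDual
import Literature.NumberTheory.GaloisRepresentations.ContinuousShapiroLiftFunctor
import Literature.NumberTheory.GaloisRepresentations.ContinuousCupProductCompat
import HarnessLib

/-!
# Route `ResidualThetaTransportAtTwo` (RTT P6, item stmt-BirchSwinnertonDyer-23110, road T), H-PLUSDUAL / ISO brick (B2):
# UNTWISTING the Shapiro model on the layer `U_J` — Kim's `f ↦ f̃(γⁱ) = f(γⁱ)/αⁱ`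

Width seat `bsd-wall-tp2-p2x-w2` g16 (cell `bsd-wall`), for the LEAD `bsd-wall-tp2-p2x` g12. HONEST FRAMING: THEOREMS ONLY
(no definition, no named fact, no instance, no `sorry`; the auxiliary objects — the twisted local Weil pairing and the untwisting
morphisms — are produced by `∃`-statements and consumed through their characteristic equations); closes no item; BSD is NOT
proved by any of this.

Setting: `W/ℚ`, `κ` a `ℤ₂`-extension, `v` a place, `ℚ_v`, `Γ_v`, `U_J = LayerPairing.layerGroup κ v J`, `s = layerReps κ v J` the K3
representatives of `Γ_v ⧸ U_J`, `M_u = E[2^J](χ_u)` (`twistedTorsionGaloisModule`), `u u' ≡ 1 (mod 2^J)`, `e` an equivariant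
biadditive `μ_{2^J}`-valued pairing on `E[2^J]`, `e(S, T) ∈ μ` packaged as `weilPairingHom`.
B. D. Kim (Compositio 143 (2007), proof of Prop. 4.11, p. 63): «There is `α ∈ 𝒪_P^×` such that a generator `γ` of `Γ` acts on
`S_P` as multiplication by `α`. Then … `φ : Hom(𝒪_P⟦Γ⟧, S_P/𝔪^k) → Hom(𝒪_P⟦Γ⟧, 𝒪_P/𝔪^k)`, `f ↦ f̃ : γⁱ ↦ f(γⁱ)/αⁱ` … is a
well-defined `𝒪_P`-isomorphism and also `Γ`-equivariant.» In the tree's Shapiro currency (`coindFin X U = Maps(Γ_v ⧸ U, X)`):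

* §1 `twistedTorsion_restrictField_apply` (`σ` acts on `M_u|` by `u^{κ(σ) mod 2^J}·res σ`), `nsmul_muCarrier_eq_zero`;
  **`exists_twistedWeilLocalPairing`**: the TWISTED LOCAL WEIL PAIRING `M_u| × M_{u'}| → μ_{2^J}|`, `(S, T) ↦ e(S, T)`, exists as a
  `ContPairing` (equivariance: `e(u^a σS, u'^a σT) = (uu')^a σ e(S,T) = σ e(S,T)`), and
  **`cupProduct_tateDual_map_twistedWeilDual`**: the local Tate (evaluation) cup product against `H¹(w) y'`
  (`w = twistedWeilDual : M_{u'} ⥲ M_u^D`) IS its cup product — the «PT-dialect link» `⟨x, H¹(w)y'⟩_v = inv_v(x ∪_e y')`;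
* §2 **`exists_coindFin_untwist`**: a morphism `Ψ_u : Maps(Γ_v ⧸ U_J, M_u|) ⟶ Maps(Γ_v ⧸ U_J, E[2^J]|)` of `Γ_v`-representations with
  `(Ψ_u φ)(y) = u'^{κ(s y) mod 2^J} • φ(y)` (equivariant because `κ(s y) ≡ κ(g) + κ(s(g⁻¹y))` modulo `2^J ℤ₂`);
  `cohomologyMap_untwist_shapiroLift`: `H¹(Ψ_u)(Sh^{tw}_J [ψ]) = Sh_J [ψ₀]` for a `U_J`-cocycle `ψ` of `M_u|` and the untwisted
  cocycle `ψ₀` with the same values (`…CoresWitness.exists_untwist_layerCocycle`);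
* §3 **`cupProduct_coindFin_twisted_eq_layerSumPairing`**: for the twisted local Weil pairing `P` of §1,
  `Sh^{tw}[f] ∪_{ΣP} Sh^{tw}[g] = Sh[f₀] ∪_{Σe} Sh[g₀]` in `H²(Γ_v, μ|)` — the twisted summed cup product on the layer IS the K3
  `layerSumPairing` cup product of the untwisted cocycles (`cupProduct_coindFin_map` along `Ψ_u × Ψ_{u'}`,
  `e(u'^a S, u^a T) = e(S, T)`).

References: B. D. Kim, Compositio Math. 143 (2007), Prop. 4.11 (proof, pp. 62–63) [BDKim2007]; J. Neukirch, A. Schmidt,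
K. Wingberg, *Cohomology of Number Fields* (2008), I §4 (1.4.2), I §6 (1.6.4) [NeukirchSchmidtWingberg2008]; J.-P. Serre,
*Local Fields* VII §5–§6 [SerreLocalFields1979]; J. S. Milne, *Arithmetic Duality Theorems* (2006), I §2, Cor. 2.3 [MilneADT2006].
-/

-- the Theorems namespace of this sub repeats the summit name by design (D-0017 nested layout)
set_option linter.dupNamespace false

noncomputable section

open scoped Classical NumberField
open CategoryTheory Function Field NumberField IsDedekindDomain

namespace Summit.BirchSwinnertonDyer.BirchSwinnertonDyer.Theorems.SignedEC.TwistedLocalKummer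

open Literature.NumberTheory.EllipticCurves Literature.NumberTheory.GaloisRepresentations WeierstrassCurve ZpExtension
  Literature.NumberTheory.EllipticCurves.Kobayashi2003 SignedKatoOffTwo
open Literature.NumberTheory.GaloisRepresentations.DiscreteGaloisModule (mu MuCarrier tateDualPairingLocal)
open Literature.NumberTheory.EllipticCurves (schreierElt schreierElt_coe)
open scoped ContRepresentation

-- Cup products need `LocallyCompactSpace Γ_v` and summed pairings `Fintype (Γ_v ⧸ U_J)`: both are taken as instance ARGUMENTS
-- (consumers supply `absoluteGaloisGroup_compactSpace _` and the K3 term `LayerPairing.layerFintypeQuot κ v J`, under which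
-- `(weilLocalPairing …).coindFin U_J` is `LayerPairing.layerSumPairing … J` by `rfl`); no local instances.

universe u

variable (W : WeierstrassCurve ℚ) [W.IsElliptic]

/-! ## §1 The twisted local Weil pairing and the PT-dialect link -/

omit [W.IsElliptic] in
/-- `σ ∈ Γ_{ℚ_v}` acts on `E[2^J](χ_u)|` by `u^{κ(σ) mod 2^J} · res σ`. [cite: GreenbergLNM1716, §4 p. 124] -/
theorem twistedTorsion_restrictField_apply (κ : ZpExtension ℚ 2) (J : ℕ) (u : ℤ) (hu : (2 : ℤ) ∣ u - 1)
    (v : HeightOneSpectrum (𝓞 ℚ)) (σ : absoluteGaloisGroup (v.adicCompletion ℚ)) (m : W.geomTorsion ((2 ^ J : ℕ) : ℤ)) :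
    (W.twistedTorsionGaloisModule 2 κ J u hu).restrictField (v.adicCompletion ℚ) σ m =
      (u ^ κ.twistExponent J (resGal (K := ℚ) (v.adicCompletion ℚ) σ)) • (resGal (K := ℚ) (v.adicCompletion ℚ) σ • m) := by
  change W.twistedTorsionGaloisModule 2 κ J u hu (resGal (K := ℚ) (v.adicCompletion ℚ) σ) m = _
  rw [ZpExtension.galoisTwist_apply_apply, torsionGaloisModule_apply_apply]

/-- `μ_{2^J}(ℚ̄)` is killed by `2^J`. [cite: MilneADT2006, Ch. I §0] -/
theorem nsmul_muCarrier_eq_zero (J : ℕ) (x : MuCarrier ℚ (2 ^ J)) : 2 ^ J • x = 0 := by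
  apply (DiscreteGaloisModule.MuCarrier.toAdditive (K := ℚ)).injective
  rw [map_nsmul, map_zero]
  apply Additive.toMul.injective
  rw [toMul_nsmul, toMul_zero]
  exact Subtype.ext (by
    rw [SubmonoidClass.coe_pow, OneMemClass.coe_one]
    exact (mem_rootsOfUnity _ _).mp (DiscreteGaloisModule.MuCarrier.toAdditive x).toMul.2)

omit [W.IsElliptic] in
/-- `e(u^a • S, u'^a • T) = e(S, T)` in `μ_{2^J}` when `2^J ∣ u u' − 1`. [cite: SilvermanAEC2009, Prop. III.8.1 (a)] -/
theorem weilPairingHom_pow_zsmul_pow_zsmul (J : ℕ) [NeZero (2 ^ J)] {u u' : ℤ} (huu' : ((2 : ℤ) ^ J) ∣ u * u' - 1)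
    (e : W.geomTorsion ((2 ^ J : ℕ) : ℤ) → W.geomTorsion ((2 ^ J : ℕ) : ℤ) → AlgebraicClosure ℚ)
    (hμ : ∀ S T, e S T ^ (2 ^ J) = 1) (hadd₁ : ∀ S₁ S₂ T, e (S₁ + S₂) T = e S₁ T * e S₂ T)
    (hadd₂ : ∀ S T₁ T₂, e S (T₁ + T₂) = e S T₁ * e S T₂) (a : ℕ) (S T : W.geomTorsion ((2 ^ J : ℕ) : ℤ)) :
    weilPairingHom W (2 ^ J) e hμ hadd₁ hadd₂ ((u ^ a) • S) ((u' ^ a) • T) = weilPairingHom W (2 ^ J) e hμ hadd₁ hadd₂ S T := by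
  have h1 : weilPairingHom W (2 ^ J) e hμ hadd₁ hadd₂ ((u ^ a) • S) ((u' ^ a) • T) =
      (u ^ a) • weilPairingHom W (2 ^ J) e hμ hadd₁ hadd₂ S ((u' ^ a) • T) := by
    rw [← AddMonoidHom.flip_apply (weilPairingHom W (2 ^ J) e hμ hadd₁ hadd₂), map_zsmul, AddMonoidHom.flip_apply]
  rw [h1, map_zsmul, smul_smul, ← mul_pow,
    ZpExtension.pow_zsmul_eq_of_dvd_sub (p := 2) (nsmul_muCarrier_eq_zero J) (u := u * u') (u' := 1) huu' a, one_pow, one_smul]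

omit [W.IsElliptic] in
/-- Galois equivariance of `e` in the additive currency: `e(σS, σT) = σ • e(S, T)` in `μ_{2^J}`. [cite: SilvermanAEC2009, Prop. III.8.1 (d)] -/
theorem weilPairingHom_smul_smul (J : ℕ) [NeZero (2 ^ J)]
    (e : W.geomTorsion ((2 ^ J : ℕ) : ℤ) → W.geomTorsion ((2 ^ J : ℕ) : ℤ) → AlgebraicClosure ℚ)
    (hμ : ∀ S T, e S T ^ (2 ^ J) = 1) (hadd₁ : ∀ S₁ S₂ T, e (S₁ + S₂) T = e S₁ T * e S₂ T)
    (hadd₂ : ∀ S T₁ T₂, e S (T₁ + T₂) = e S T₁ * e S T₂)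
    (hgal : ∀ (σ : absoluteGaloisGroup ℚ) (S T : W.geomTorsion ((2 ^ J : ℕ) : ℤ)), σ • e S T = e (σ • S) (σ • T))
    (σ : absoluteGaloisGroup ℚ) (S T : W.geomTorsion ((2 ^ J : ℕ) : ℤ)) :
    weilPairingHom W (2 ^ J) e hμ hadd₁ hadd₂ (σ • S) (σ • T) = mu ℚ (2 ^ J) σ (weilPairingHom W (2 ^ J) e hμ hadd₁ hadd₂ S T) := by
  have h := (weilContPairing W (2 ^ J) e hμ hadd₁ hadd₂ hgal).toLin_smul σ S T
  rw [weilContPairing_toLin_apply, weilContPairing_toLin_apply] at h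
  change weilPairingHom W (2 ^ J) e hμ hadd₁ hadd₂ (W.torsionGaloisModule ((2 ^ J : ℕ) : ℤ) σ S)
    (W.torsionGaloisModule ((2 ^ J : ℕ) : ℤ) σ T) = _ at h
  rwa [torsionGaloisModule_apply_apply, torsionGaloisModule_apply_apply] at h

omit [W.IsElliptic] in
/-- **The twisted local Weil pairing exists as a continuous equivariant pairing** `M_u| × M_{u'}| → μ_{2^J}|` with
`(S, T) ↦ e(S, T)` (`u u' ≡ 1 (mod 2^J)`): `e(u^a σS, u'^a σT) = (u u')^a • σ e(S, T) = σ e(S, T)`. [cite: BDKim2007, Lemma 4.2] -/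
theorem exists_twistedWeilLocalPairing (κ : ZpExtension ℚ 2) (J : ℕ) {u u' : ℤ} (hu : (2 : ℤ) ∣ u - 1) (hu' : (2 : ℤ) ∣ u' - 1)
    (huu' : ((2 : ℤ) ^ J) ∣ u * u' - 1) (v : HeightOneSpectrum (𝓞 ℚ))
    (e : W.geomTorsion ((2 ^ J : ℕ) : ℤ) → W.geomTorsion ((2 ^ J : ℕ) : ℤ) → AlgebraicClosure ℚ)
    (hμ : ∀ S T, e S T ^ (2 ^ J) = 1) (hadd₁ : ∀ S₁ S₂ T, e (S₁ + S₂) T = e S₁ T * e S₂ T)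
    (hadd₂ : ∀ S T₁ T₂, e S (T₁ + T₂) = e S T₁ * e S T₂)
    (hgal : ∀ (σ : absoluteGaloisGroup ℚ) (S T : W.geomTorsion ((2 ^ J : ℕ) : ℤ)), σ • e S T = e (σ • S) (σ • T)) :
    ∃ P : ContPairing ((W.twistedTorsionGaloisModule 2 κ J u hu).restrictField (v.adicCompletion ℚ)).toTopRep
        ((W.twistedTorsionGaloisModule 2 κ J u' hu').restrictField (v.adicCompletion ℚ)).toTopRep (LayerPairing.muLocalRep (2 ^ J) v),
      ∀ S T, P.toLin S T = weilPairingHom W (2 ^ J) e hμ hadd₁ hadd₂ S T := by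
  haveI : NeZero (2 ^ J) := ⟨pow_ne_zero _ two_ne_zero⟩
  refine ⟨DiscreteGaloisModule.pairing ((W.twistedTorsionGaloisModule 2 κ J u hu).restrictField (v.adicCompletion ℚ))
    ((W.twistedTorsionGaloisModule 2 κ J u' hu').restrictField (v.adicCompletion ℚ))
    ((mu ℚ (2 ^ J)).restrictField (v.adicCompletion ℚ)) (weilPairingHom W (2 ^ J) e hμ hadd₁ hadd₂) fun σ S T ↦ ?_, fun _ _ ↦ rfl⟩
  rw [twistedTorsion_restrictField_apply, twistedTorsion_restrictField_apply, weilPairingHom_pow_zsmul_pow_zsmul W J huu',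
    weilPairingHom_smul_smul W J e hμ hadd₁ hadd₂ hgal]
  rfl

/-- **The PT-dialect link.** For any pairing `P` as in `exists_twistedWeilLocalPairing` (`P(S, T) = e(S, T)`), the local Tate
(evaluation) cup product of `x ∈ H¹(ℚ_v, M_u)` against the Weil-dual image `H¹(w) y'` of `y' ∈ H¹(ℚ_v, M_{u'})`
(`w = twistedWeilDual`, `(w T) S = e(S, T)`) is the cup product `x ∪_P y'` (adjoint naturality `cupProduct_adjoint`); so
`localTatePairingZMod … x (H¹(w) y') = inv_v (x ∪_P y')`. [cite: MilneADT2006, Ch. I Cor. 2.3] [cite: BDKim2007, §4.1 (H3)] -/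
theorem cupProduct_tateDual_map_twistedWeilDual (κ : ZpExtension ℚ 2) (J : ℕ) {u u' : ℤ} (hu : (2 : ℤ) ∣ u - 1)
    (hu' : (2 : ℤ) ∣ u' - 1) (huu' : ((2 : ℤ) ^ J) ∣ u * u' - 1) (v : HeightOneSpectrum (𝓞 ℚ))
    (e : W.geomTorsion ((2 ^ J : ℕ) : ℤ) → W.geomTorsion ((2 ^ J : ℕ) : ℤ) → AlgebraicClosure ℚ)
    (hμ : ∀ S T, e S T ^ (2 ^ J) = 1) (hadd₁ : ∀ S₁ S₂ T, e (S₁ + S₂) T = e S₁ T * e S₂ T)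
    (hadd₂ : ∀ S T₁ T₂, e S (T₁ + T₂) = e S T₁ * e S T₂)
    (hgal : ∀ (σ : absoluteGaloisGroup ℚ) (S T : W.geomTorsion ((2 ^ J : ℕ) : ℤ)), σ • e S T = e (σ • S) (σ • T))
    [Finite (W.geomTorsion ((2 ^ J : ℕ) : ℤ))] [CompactSpace (absoluteGaloisGroup (v.adicCompletion ℚ))]
    (P : ContPairing ((W.twistedTorsionGaloisModule 2 κ J u hu).restrictField (v.adicCompletion ℚ)).toTopRep
        ((W.twistedTorsionGaloisModule 2 κ J u' hu').restrictField (v.adicCompletion ℚ)).toTopRep (LayerPairing.muLocalRep (2 ^ J) v))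
    (hP : ∀ S T, P.toLin S T = weilPairingHom W (2 ^ J) e hμ hadd₁ hadd₂ S T)
    (x : galoisCohomology ((W.twistedTorsionGaloisModule 2 κ J u hu).restrictField (v.adicCompletion ℚ)) 1)
    (y' : galoisCohomology ((W.twistedTorsionGaloisModule 2 κ J u' hu').restrictField (v.adicCompletion ℚ)) 1) :
    DiscreteGaloisModule.localTatePairing (W.twistedTorsionGaloisModule 2 κ J u hu) (2 ^ J) (Sum.inr v) x
        (galoisCohomology.map ((W.twistedWeilDual 2 κ J hu hu' huu' e hμ hadd₁ hadd₂ hgal).restrictField (v.adicCompletion ℚ)) 1 y') =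
      P.cupProduct x y' := by
  -- the evaluation pairing, typed over `ℚ_v` (`Place.Completion (Sum.inr v)` is `v.adicCompletion ℚ` by definition)
  let TDL : ContPairing ((W.twistedTorsionGaloisModule 2 κ J u hu).restrictField (v.adicCompletion ℚ)).toTopRep
      ((((W.twistedTorsionGaloisModule 2 κ J u hu).tateDual (2 ^ J)).restrictField (v.adicCompletion ℚ)).toTopRep)
      (LayerPairing.muLocalRep (2 ^ J) v) :=
    tateDualPairingLocal (W.twistedTorsionGaloisModule 2 κ J u hu) (2 ^ J) (Sum.inr v)
  let β : ((W.twistedTorsionGaloisModule 2 κ J u' hu').restrictField (v.adicCompletion ℚ)).toTopRep ⟶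
      (((W.twistedTorsionGaloisModule 2 κ J u hu).tateDual (2 ^ J)).restrictField (v.adicCompletion ℚ)).toTopRep :=
    TopRep.ofHom ⟨((W.twistedWeilDual 2 κ J hu hu' huu' e hμ hadd₁ hadd₂ hgal).restrictField (v.adicCompletion ℚ)).toContinuousLinearMap,
      ((W.twistedWeilDual 2 κ J hu hu' huu' e hμ hadd₁ hadd₂ hgal).restrictField (v.adicCompletion ℚ)).isIntertwining'⟩
  have h := ContPairing.cupProduct_adjoint TDL P
    (𝟙 ((W.twistedTorsionGaloisModule 2 κ J u hu).restrictField (v.adicCompletion ℚ)).toTopRep) β (fun S T ↦ by rw [hP]; rfl) x y'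
  have h1 : cohomologyMap (𝟙 ((W.twistedTorsionGaloisModule 2 κ J u hu).restrictField (v.adicCompletion ℚ)).toTopRep) 1 x = x := by
    rw [show cohomologyMap (𝟙 ((W.twistedTorsionGaloisModule 2 κ J u hu).restrictField (v.adicCompletion ℚ)).toTopRep) 1 = 𝟙 _
      from map_id_eq_id _ (fun _ => rfl) 1]
    rfl
  rw [h1] at h
  exact h.symm

/-! ## §2 Untwisting the Shapiro model on the layer `U_J` -/

omit [W.IsElliptic] in
/-- **Exponent bookkeeping along a coset**: for the K3 representatives `s` of `Γ_v ⧸ U_J`, `g ∈ Γ_v` and a coset `y`,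
`κ(s y) ≡ κ(g) + κ(s(g⁻¹ y))` modulo `2^J` — exactly, on canonical representatives: `s(y)` and `g·s(g⁻¹y)` lie in the same
coset of `U_J = κ⁻¹(2^J ℤ₂)`. [cite: Washington1997, §13.1] -/
theorem twistExponent_layerReps_eq (κ : ZpExtension ℚ 2) (J : ℕ) (v : HeightOneSpectrum (𝓞 ℚ))
    (g : absoluteGaloisGroup (v.adicCompletion ℚ)) (y : absoluteGaloisGroup (v.adicCompletion ℚ) ⧸ LayerPairing.layerGroup κ v J) :
    κ.twistExponent J (resGal (K := ℚ) (v.adicCompletion ℚ) (LayerPairing.layerReps κ v J y)) =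
      (κ.twistExponent J (resGal (K := ℚ) (v.adicCompletion ℚ) g) +
        κ.twistExponent J (resGal (K := ℚ) (v.adicCompletion ℚ) (LayerPairing.layerReps κ v J (g⁻¹ • y)))) % 2 ^ J := by
  set a := LayerPairing.layerReps κ v J y with ha
  set b := g * LayerPairing.layerReps κ v J (g⁻¹ • y) with hb
  have hab : a⁻¹ * b ∈ LayerPairing.layerGroup κ v J := by
    rw [← QuotientGroup.eq, ha, hb, LayerPairing.layerReps_spec, ← smul_eq_mul g, ← MulAction.Quotient.smul_coe,
      LayerPairing.layerReps_spec, smul_inv_smul]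
  have hab' : resGal (K := ℚ) (v.adicCompletion ℚ) (a⁻¹ * b) ∈ κ.layerSubgroup J := (mem_localSubgroupOfEmb_iff _ _ _).mp hab
  have h0 : κ.twistExponent J (resGal (K := ℚ) (v.adicCompletion ℚ) (a⁻¹ * b)) = 0 := κ.twistExponent_eq_zero_of_mem_layerSubgroup hab'
  have h1 : κ.twistExponent J (resGal (K := ℚ) (v.adicCompletion ℚ) b) = κ.twistExponent J (resGal (K := ℚ) (v.adicCompletion ℚ) a) := by
    conv_lhs => rw [show b = a * (a⁻¹ * b) by group, map_mul, ZpExtension.twistExponent_mul, h0, add_zero,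
      Nat.mod_eq_of_lt (κ.twistExponent_lt J _)]
  rw [← h1, hb, map_mul, ZpExtension.twistExponent_mul]

omit [W.IsElliptic] in
/-- **The untwisting morphism `Ψ_u : Maps(Γ_v ⧸ U_J, M_u|) ⟶ Maps(Γ_v ⧸ U_J, E[2^J]|)` exists**:
`(Ψ_u φ)(y) = u'^{κ(s y) mod 2^J} • φ(y)` (`u u' ≡ 1 (mod 2^J)`, `s` the K3 representatives) is `Γ_v`-equivariant for the diagonal
actions — Kim's «`f ↦ f̃ : γⁱ ↦ f(γⁱ)/αⁱ` … well-defined and `Γ`-equivariant». [cite: BDKim2007, Prop. 4.11 (proof, p. 63)] -/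
theorem exists_coindFin_untwist (κ : ZpExtension ℚ 2) (J : ℕ) {u u' : ℤ} (hu : (2 : ℤ) ∣ u - 1) (hu' : (2 : ℤ) ∣ u' - 1)
    (huu' : ((2 : ℤ) ^ J) ∣ u * u' - 1) (v : HeightOneSpectrum (𝓞 ℚ)) :
    ∃ Ψ : coindFin ((W.twistedTorsionGaloisModule 2 κ J u hu).restrictField (v.adicCompletion ℚ)).toTopRep (LayerPairing.layerGroup κ v J) ⟶
        coindFin (LayerPairing.torsionLocalRep W (2 ^ J) v) (LayerPairing.layerGroup κ v J),
      ∀ φ y, Ψ.hom φ y = (u' ^ κ.twistExponent J (resGal (K := ℚ) (v.adicCompletion ℚ) (LayerPairing.layerReps κ v J y))) • φ y := by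
  have hM : ∀ m : W.geomTorsion ((2 ^ J : ℕ) : ℤ), 2 ^ J • m = 0 := fun m ↦ W.pow_nsmul_geomTorsion_pow 2 J m
  have huu'' : ((2 : ℤ) ^ J) ∣ u' * u - 1 := by rwa [mul_comm] at huu'
  let c : absoluteGaloisGroup (v.adicCompletion ℚ) ⧸ LayerPairing.layerGroup κ v J → ℤ := fun y ↦
    u' ^ κ.twistExponent J (resGal (K := ℚ) (v.adicCompletion ℚ) (LayerPairing.layerReps κ v J y))
  refine ⟨TopRep.ofHom
    { toContinuousLinearMap :=
        { toFun := fun φ => fun y => c y • φ y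
          map_add' := fun φ φ' => funext fun y => by
            change c y • ((φ + φ') y) = c y • φ y + c y • φ' y
            rw [Pi.add_apply, smul_add]
          map_smul' := fun r φ => funext fun y => by
            change c y • ((r • φ) y) = r • (c y • φ y)
            rw [Pi.smul_apply, smul_comm]
          cont := continuous_pi fun y => continuous_of_discreteTopology.comp (continuous_apply y) }
      isIntertwining' := fun g => by
        refine ContinuousLinearMap.ext fun φ => funext fun y => ?_
        change c y • ((((W.twistedTorsionGaloisModule 2 κ J u hu).restrictField (v.adicCompletion ℚ)).toTopRep).ρ g (φ (g⁻¹ • y))) =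
          (LayerPairing.torsionLocalRep W (2 ^ J) v).ρ g (c (g⁻¹ • y) • φ (g⁻¹ • y))
        rw [map_zsmul, torsionLocalRep_ρ_apply]
        change c y • ((W.twistedTorsionGaloisModule 2 κ J u hu).restrictField (v.adicCompletion ℚ) g (φ (g⁻¹ • y))) = _
        rw [twistedTorsion_restrictField_apply, smul_smul, show c y = u' ^ κ.twistExponent J (resGal (K := ℚ) (v.adicCompletion ℚ)
          (LayerPairing.layerReps κ v J y)) from rfl, twistExponent_layerReps_eq κ J v g y, ← smul_smul,
          ZpExtension.pow_mod_zsmul_eq (p := 2) hM hu', smul_smul, pow_add,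
          show u' ^ κ.twistExponent J (resGal (K := ℚ) (v.adicCompletion ℚ) g) *
              u' ^ κ.twistExponent J (resGal (K := ℚ) (v.adicCompletion ℚ) (LayerPairing.layerReps κ v J (g⁻¹ • y))) *
              u ^ κ.twistExponent J (resGal (K := ℚ) (v.adicCompletion ℚ) g) =
            u' ^ κ.twistExponent J (resGal (K := ℚ) (v.adicCompletion ℚ) (LayerPairing.layerReps κ v J (g⁻¹ • y))) *
              (u' * u) ^ κ.twistExponent J (resGal (K := ℚ) (v.adicCompletion ℚ) g) by ring,
          ← smul_smul, ZpExtension.pow_zsmul_eq_of_dvd_sub (p := 2) hM (u := u' * u) (u' := 1) huu'', one_pow, one_smul] }, fun φ y ↦ rfl⟩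

omit [W.IsElliptic] in
/-- **`Ψ_u` carries the twisted Shapiro lift to the untwisted one**: for a `U_J`-cocycle `ψ` of `M_u|` and the untwisted cocycle
`ψ₀` with the same values, `H¹(Ψ_u)(Sh^{tw}_J[ψ]) = Sh_J[ψ₀]` (`= layerShapiro`), ON THE NOSE on cocycles:
`u'^{κ(s y)} • (u^{κ(s y)} s(y)) • ψ(⋯) = s(y) • ψ₀(⋯)`. [cite: BDKim2007, Prop. 4.11 (proof, p. 63)] [cite: NeukirchSchmidtWingberg2008, I §6 (1.6.4)] -/
theorem cohomologyMap_untwist_shapiroLift (κ : ZpExtension ℚ 2) (J : ℕ) {u u' : ℤ} (hu : (2 : ℤ) ∣ u - 1)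
    (huu' : ((2 : ℤ) ^ J) ∣ u * u' - 1) (v : HeightOneSpectrum (𝓞 ℚ))
    (Ψ : coindFin ((W.twistedTorsionGaloisModule 2 κ J u hu).restrictField (v.adicCompletion ℚ)).toTopRep (LayerPairing.layerGroup κ v J) ⟶
        coindFin (LayerPairing.torsionLocalRep W (2 ^ J) v) (LayerPairing.layerGroup κ v J))
    (hΨ : ∀ φ y, Ψ.hom φ y = (u' ^ κ.twistExponent J (resGal (K := ℚ) (v.adicCompletion ℚ) (LayerPairing.layerReps κ v J y))) • φ y)
    (ψ : contOneCocycles (subgroupRep ((W.twistedTorsionGaloisModule 2 κ J u hu).restrictField (v.adicCompletion ℚ)).toTopRep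
      (LayerPairing.layerGroup κ v J)))
    (ψ₀ : contOneCocycles (subgroupRep (LayerPairing.torsionLocalRep W (2 ^ J) v) (LayerPairing.layerGroup κ v J)))
    (hψ₀ : ∀ τ, ψ₀.1 τ = ψ.1 τ) :
    cohomologyMap Ψ 1 (shapiroLift ((W.twistedTorsionGaloisModule 2 κ J u hu).restrictField (v.adicCompletion ℚ)).toTopRep
        (LayerPairing.layerGroup κ v J) (LayerPairing.isOpen_layerGroup κ v J) (LayerPairing.layerReps_spec κ v J)
        (LayerPairing.layerReps_one κ v J) (oneCocycleClass _ ψ)) =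
      LayerPairing.layerShapiro W (2 ^ J) κ v J (oneCocycleClass _ ψ₀) := by
  have hM : ∀ m : W.geomTorsion ((2 ^ J : ℕ) : ℤ), 2 ^ J • m = 0 := fun m ↦ W.pow_nsmul_geomTorsion_pow 2 J m
  have huu'' : ((2 : ℤ) ^ J) ∣ u' * u - 1 := by rwa [mul_comm] at huu'
  unfold LayerPairing.layerShapiro
  rw [shapiroLift_oneCocycleClass, shapiroLift_oneCocycleClass, cohomologyMap_oneCocycleClass]
  congr 1
  apply Subtype.ext
  ext g
  funext y
  rw [pullback_id_resIdHom_apply, hΨ, shapiroCocycle_apply, shapiroCocycle_apply, hψ₀, torsionLocalRep_ρ_apply]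
  change (u' ^ _) • ((W.twistedTorsionGaloisModule 2 κ J u hu).restrictField (v.adicCompletion ℚ) (LayerPairing.layerReps κ v J y) _) = _
  rw [twistedTorsion_restrictField_apply, smul_smul, ← mul_pow,
    ZpExtension.pow_zsmul_eq_of_dvd_sub (p := 2) hM (u := u' * u) (u' := 1) huu'', one_pow, one_smul]

/-! ## §3 The twisted summed cup product on the layer IS the K3 layer cup product of the untwisted cocycles -/

variable (κ : ZpExtension ℚ 2) (J : ℕ) {u u' : ℤ} (hu : (2 : ℤ) ∣ u - 1) (hu' : (2 : ℤ) ∣ u' - 1)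
  (huu' : ((2 : ℤ) ^ J) ∣ u * u' - 1) (v : HeightOneSpectrum (𝓞 ℚ))
  (e : W.geomTorsion ((2 ^ J : ℕ) : ℤ) → W.geomTorsion ((2 ^ J : ℕ) : ℤ) → AlgebraicClosure ℚ)
  (hμ : ∀ S T, e S T ^ (2 ^ J) = 1) (hadd₁ : ∀ S₁ S₂ T, e (S₁ + S₂) T = e S₁ T * e S₂ T)
  (hadd₂ : ∀ S T₁ T₂, e S (T₁ + T₂) = e S T₁ * e S T₂)
  (hgal : ∀ (σ : absoluteGaloisGroup ℚ) (S T : W.geomTorsion ((2 ^ J : ℕ) : ℤ)), σ • e S T = e (σ • S) (σ • T))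

include huu' in
omit [W.IsElliptic] in
/-- **Untwisting the layer cup product.** For the twisted local Weil pairing `P` (`P(S,T) = e(S,T)`), untwisting morphisms
`Ψ_u` (scalar `u'^{κ(s y)}`) and `Ψ_{u'}` (scalar `u^{κ(s y)}`), twisted `U_J`-cocycles `f` of `M_u|`, `g` of `M_{u'}|` and the
untwisted `U_J`-cocycles `f₀`, `g₀` with the same values:
`Sh^{tw}[f] ∪_{ΣP} Sh^{tw}[g] = Sh[f₀] ∪_{Σe} Sh[g₀]` in `H²(Γ_v, μ_{2^J}|)`, the right side being the K3 layer pairing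
(`(weilLocalPairing …).coindFin U_J = layerSumPairing … J` under the K3 instance `layerFintypeQuot`) on `layerShapiro` classes
(`cupProduct_map` along `Ψ_u × Ψ_{u'}`, `e(u'^a S, u^a T) = e(S, T)`).
[cite: BDKim2007, Prop. 4.11 (proof, pp. 62–63)] [cite: NeukirchSchmidtWingberg2008, I §4 (1.4.2)] -/
theorem cupProduct_coindFin_twisted_eq_layerSumPairing [NeZero (2 ^ J)] [CompactSpace (absoluteGaloisGroup (v.adicCompletion ℚ))]
    [Fintype (absoluteGaloisGroup (v.adicCompletion ℚ) ⧸ LayerPairing.layerGroup κ v J)]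
    (P : ContPairing ((W.twistedTorsionGaloisModule 2 κ J u hu).restrictField (v.adicCompletion ℚ)).toTopRep
        ((W.twistedTorsionGaloisModule 2 κ J u' hu').restrictField (v.adicCompletion ℚ)).toTopRep (LayerPairing.muLocalRep (2 ^ J) v))
    (hP : ∀ S T, P.toLin S T = weilPairingHom W (2 ^ J) e hμ hadd₁ hadd₂ S T)
    (Ψ : coindFin ((W.twistedTorsionGaloisModule 2 κ J u hu).restrictField (v.adicCompletion ℚ)).toTopRep (LayerPairing.layerGroup κ v J) ⟶
        coindFin (LayerPairing.torsionLocalRep W (2 ^ J) v) (LayerPairing.layerGroup κ v J))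
    (hΨ : ∀ φ y, Ψ.hom φ y = (u' ^ κ.twistExponent J (resGal (K := ℚ) (v.adicCompletion ℚ) (LayerPairing.layerReps κ v J y))) • φ y)
    (Ψ' : coindFin ((W.twistedTorsionGaloisModule 2 κ J u' hu').restrictField (v.adicCompletion ℚ)).toTopRep (LayerPairing.layerGroup κ v J) ⟶
        coindFin (LayerPairing.torsionLocalRep W (2 ^ J) v) (LayerPairing.layerGroup κ v J))
    (hΨ' : ∀ φ y, Ψ'.hom φ y = (u ^ κ.twistExponent J (resGal (K := ℚ) (v.adicCompletion ℚ) (LayerPairing.layerReps κ v J y))) • φ y)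
    (f : contOneCocycles (subgroupRep ((W.twistedTorsionGaloisModule 2 κ J u hu).restrictField (v.adicCompletion ℚ)).toTopRep
      (LayerPairing.layerGroup κ v J)))
    (g : contOneCocycles (subgroupRep ((W.twistedTorsionGaloisModule 2 κ J u' hu').restrictField (v.adicCompletion ℚ)).toTopRep
      (LayerPairing.layerGroup κ v J)))
    (f₀ g₀ : contOneCocycles (subgroupRep (LayerPairing.torsionLocalRep W (2 ^ J) v) (LayerPairing.layerGroup κ v J)))
    (hf₀ : ∀ τ, f₀.1 τ = f.1 τ) (hg₀ : ∀ τ, g₀.1 τ = g.1 τ) :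
    (P.coindFin (LayerPairing.layerGroup κ v J)).cupProduct
        (shapiroLift ((W.twistedTorsionGaloisModule 2 κ J u hu).restrictField (v.adicCompletion ℚ)).toTopRep
          (LayerPairing.layerGroup κ v J) (LayerPairing.isOpen_layerGroup κ v J) (LayerPairing.layerReps_spec κ v J)
          (LayerPairing.layerReps_one κ v J) (oneCocycleClass _ f))
        (shapiroLift ((W.twistedTorsionGaloisModule 2 κ J u' hu').restrictField (v.adicCompletion ℚ)).toTopRep
          (LayerPairing.layerGroup κ v J) (LayerPairing.isOpen_layerGroup κ v J) (LayerPairing.layerReps_spec κ v J)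
          (LayerPairing.layerReps_one κ v J) (oneCocycleClass _ g)) =
      ((LayerPairing.weilLocalPairing W (2 ^ J) e hμ hadd₁ hadd₂ hgal v).coindFin (LayerPairing.layerGroup κ v J)).cupProduct
        (LayerPairing.layerShapiro W (2 ^ J) κ v J (oneCocycleClass _ f₀))
        (LayerPairing.layerShapiro W (2 ^ J) κ v J (oneCocycleClass _ g₀)) := by
  have huu'' : ((2 : ℤ) ^ J) ∣ u' * u - 1 := by rwa [mul_comm] at huu'
  have hc : ∀ φ φ', (𝟙 (LayerPairing.muLocalRep (2 ^ J) v) : LayerPairing.muLocalRep (2 ^ J) v ⟶ LayerPairing.muLocalRep (2 ^ J) v).hom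
      ((P.coindFin (LayerPairing.layerGroup κ v J)).toLin φ φ') =
      ((LayerPairing.weilLocalPairing W (2 ^ J) e hμ hadd₁ hadd₂ hgal v).coindFin (LayerPairing.layerGroup κ v J)).toLin
        (Ψ.hom φ) (Ψ'.hom φ') := by
    intro φ φ'
    change (P.coindFin (LayerPairing.layerGroup κ v J)).toLin φ φ' = _
    rw [ContPairing.coindFin_toLin_apply, ContPairing.coindFin_toLin_apply]
    refine Finset.sum_congr rfl fun y _ ↦ ?_
    rw [hP, LayerPairing.weilLocalPairing_toLin_apply, hΨ, hΨ', weilPairingHom_pow_zsmul_pow_zsmul W J huu'']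
  have h := ContPairing.cupProduct_map (P.coindFin (LayerPairing.layerGroup κ v J))
    ((LayerPairing.weilLocalPairing W (2 ^ J) e hμ hadd₁ hadd₂ hgal v).coindFin (LayerPairing.layerGroup κ v J)) Ψ Ψ'
    (𝟙 (LayerPairing.muLocalRep (2 ^ J) v)) hc
    (shapiroLift ((W.twistedTorsionGaloisModule 2 κ J u hu).restrictField (v.adicCompletion ℚ)).toTopRep
      (LayerPairing.layerGroup κ v J) (LayerPairing.isOpen_layerGroup κ v J) (LayerPairing.layerReps_spec κ v J)
      (LayerPairing.layerReps_one κ v J) (oneCocycleClass _ f))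
    (shapiroLift ((W.twistedTorsionGaloisModule 2 κ J u' hu').restrictField (v.adicCompletion ℚ)).toTopRep
      (LayerPairing.layerGroup κ v J) (LayerPairing.isOpen_layerGroup κ v J) (LayerPairing.layerReps_spec κ v J)
      (LayerPairing.layerReps_one κ v J) (oneCocycleClass _ g))
  rw [LayerPairing.cohomologyMap_id_muLocalRep, cohomologyMap_untwist_shapiroLift W κ J hu huu' v Ψ hΨ f f₀ hf₀,
    cohomologyMap_untwist_shapiroLift W κ J hu' huu'' v Ψ' hΨ' g g₀ hg₀] at h
  exact h

end Summit.BirchSwinnertonDyer.BirchSwinnertonDyer.Theorems.SignedEC.TwistedLocalKummer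

end
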